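import Summits.AtomisticToContinuum.Crystallization.Theorems.OverbindingBudgetAffineCompressedCutFrame

/-!
# `OverbindingBudget` / crux `RobustDefectLimitWindows` (stmt-AtomisticToContinuum-31280) — «RunCut»: RE-BASING the layer-rigidity cone under SW♭ (the LR ATLAS, plumbing)

Support file (lens-4 g87, part 9; memo `g87/memo/SW-CHI.md` §10 «D1-LR», order (2a)).  The sibling leaf «CompressedCut» owns the LAYER-RIGIDITY cone whose summit is
`…CompressedCutReading.layer_rigidity_record` (LR(r₁ = 106/25)): from chart data with the five ball hypotheses on the `12·ν_i`-ball of a base site `i` it returns a Barlow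
STACKING DATUM (sign class, layer word `Cz ℓ`, references, every box label ESTABLISHED with an isometry carrying the site's own pattern onto the aligned copy, every site of the
`(106/25)ν_i`-ball labelled).  SW♭'s rigid-run sites carry `AffDeepReg 24 (1/10^4) (1/1000) (1/450)` — the SAME tolerances at radius 24 — so the cone RE-BASES at every site of
the inner half of that ball.  This file is the plumbing (no new constants, no new mathematics):

* §1 `affDeepReg_rebase` (`AffDeepReg ρ` at `c` and `ρ'·ν_i + dist (y i) (y c) ≤ ρ·ν_c` ⇒ `AffDeepReg ρ'` at `i`; radius monotonicity is the tree's
  `…RunCutFlat.affDeepReg_of_radius_le`), `nearestDist_pos_of_affFramed`, `nearestDist_pos_of_affDeepReg`;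
* §2 ★ `layer_rigidity_rebase`: `AffDeepReg 24 …` at `c`, `12·ν_i + dist (y i) (y c) ≤ 24·ν_c` ⇒ the full conclusion of `…Frame.layer_rigidity_of_affDeepReg` AT `i`
  (chart data chosen at `i`; enough for single-ball uses such as the datum at the pivot, memo §10.5 (T2));
* §3 ONE chart datum for the whole atlas (needed by the atlas-gluing lemma, memo §10.3, which compares two data through the COMMON own-chart frame `ν_m • A m`):
  `charts_of_affDeepReg_radius` (the tree's `charts_of_affDeepReg` with the radius generic), `ball_restrict` (a clause on the `ρ·ν_c`-ball restricts to the `12·ν_i`-ball),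
  ★★ `layer_rigidity_rebase_charts`: GIVEN chart data with the five ball hypotheses on `B(y c, ρ·ν_c)`, every `i` with `12·ν_i + dist (y i) (y c) ≤ ρ·ν_c` gets the conclusion
  of `layer_rigidity_record` in the frame `(ν_i • A i) ∘ flipIso s` built from THAT data.
[this file: 0 definitions, 7 theorems; imports `…CompressedCutFrame` only; standard axioms]
-/

namespace Summit.AtomisticToContinuum.Crystallization.Theorems.OverbindingBudgetAffineRunCutRebase

open Literature.Geometry.DiscreteGeometry (nearestDist nearestDist_nonneg fccTwoShellPattern hcpTwoShellPattern)
open Summit.AtomisticToContinuum.Crystallization.Theorems.OverbindingBudgetAffineLadder (AffFramed AffReg AffDeepReg)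
open Summit.AtomisticToContinuum.Crystallization.Theorems.OverbindingBudgetAffineCompressedCutKernel (T3 tsub tadd thsum fccL fccNegL hcpL hcpAltL)
open Summit.AtomisticToContinuum.Crystallization.Theorems.OverbindingBudgetAffineCompressedCutCharts (mv)
open Summit.AtomisticToContinuum.Crystallization.Theorems.OverbindingBudgetAffineCompressedCutEstablish (Estab base_lower nearestDist_pos_of_frame)
open Summit.AtomisticToContinuum.Crystallization.Theorems.OverbindingBudgetAffineCompressedCutEstablishTwo (IsSign flipIso)
open Summit.AtomisticToContinuum.Crystallization.Theorems.OverbindingBudgetAffineCompressedCutSeed (InLayer)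
open Summit.AtomisticToContinuum.Crystallization.Theorems.OverbindingBudgetAffineCompressedCutPatch (capv dL)
open Summit.AtomisticToContinuum.Crystallization.Theorems.OverbindingBudgetAffineCompressedCutBudget (tauR dR)
open Summit.AtomisticToContinuum.Crystallization.Theorems.OverbindingBudgetAffineCompressedCutReading (layer_rigidity_record)
open Summit.AtomisticToContinuum.Crystallization.Theorems.OverbindingBudgetAffineCompressedCutFrame (base_upper layer_rigidity_of_affDeepReg)

variable {N : ℕ}

/-! ## §1 Re-basing affine deep registration -/

/-- **RE-BASING `AffDeepReg`**: if every site within `ρ·ν_c` of `y c` is affinely registered and the `ρ'·ν_i`-ball of `y i` lies inside (`ρ'·ν_i + dist (y i) (y c) ≤ ρ·ν_c`),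
then every site within `ρ'·ν_i` of `y i` is affinely registered. [this file · kind: glue] -/
theorem affDeepReg_rebase {ρ ρ' ε θ g : ℝ} {y : Fin N → EuclideanSpace ℝ (Fin 3)} {c i : Fin N} (hreg : AffDeepReg ρ ε θ g y c)
    (hi : ρ' * nearestDist y i + dist (y i) (y c) ≤ ρ * nearestDist y c) : AffDeepReg ρ' ε θ g y i := by
  intro m hm
  apply hreg m
  calc dist (y m) (y c) ≤ dist (y m) (y i) + dist (y i) (y c) := dist_triangle _ _ _
    _ ≤ ρ' * nearestDist y i + dist (y i) (y c) := by linarith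
    _ ≤ ρ * nearestDist y c := hi

/-- An affinely framed site of an injective configuration has `0 < ν`. [this file · kind: glue] -/
theorem nearestDist_pos_of_affFramed {ε θ g : ℝ} {y : Fin N → EuclideanSpace ℝ (Fin 3)} (hy : Function.Injective y) {i : Fin N}
    (h : AffFramed ε θ g y i) : 0 < nearestDist y i := by
  obtain ⟨Q, A, P, f, hP, -, hf, hinj, -⟩ := h
  exact nearestDist_pos_of_frame hy hP (fun v hv => (hf v hv).1) hinj

/-- The base of an `AffDeepReg ρ` ball (`0 ≤ ρ`) has `0 < ν`. [this file · kind: glue] -/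
theorem nearestDist_pos_of_affDeepReg {ρ ε θ g : ℝ} {y : Fin N → EuclideanSpace ℝ (Fin 3)} (hy : Function.Injective y) {i : Fin N} (hρ : 0 ≤ ρ)
    (h : AffDeepReg ρ ε θ g y i) : 0 < nearestDist y i :=
  nearestDist_pos_of_affFramed hy (h i (by rw [dist_self]; exact mul_nonneg hρ (nearestDist_nonneg y i))).2

/-! ## §2 Layer rigidity at every site of the inner half of the `24ν`-ball -/

/-- ★ **LAYER RIGIDITY RE-BASED** (single-ball form): `AffDeepReg 24 (1/10^4) (1/1000) (1/450) y c` and `12·ν_i + dist (y i) (y c) ≤ 24·ν_c` give, AT THE BASE `i`,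
the full conclusion of `…CompressedCutFrame.layer_rigidity_of_affDeepReg` (chart data with the five ball hypotheses on `B(y i, 12ν_i)` and the stacking datum with all
six clauses of `…CompressedCutReading.layer_rigidity_record`). [this file · kind: proof] -/
theorem layer_rigidity_rebase {y : Fin N → EuclideanSpace ℝ (Fin 3)} (hy : Function.Injective y) {c i : Fin N}
    (hreg : AffDeepReg 24 (1 / 10 ^ 4) (1 / 1000) (1 / 450) y c) (hi : 12 * nearestDist y i + dist (y i) (y c) ≤ 24 * nearestDist y c) :
    ∃ (A : Fin N → (EuclideanSpace ℝ (Fin 3) →ₗ[ℝ] EuclideanSpace ℝ (Fin 3))) (Qf : Fin N → (EuclideanSpace ℝ (Fin 3) →ₗᵢ[ℝ] EuclideanSpace ℝ (Fin 3)))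
      (P : Fin N → Finset (EuclideanSpace ℝ (Fin 3))) (f : Fin N → EuclideanSpace ℝ (Fin 3) → EuclideanSpace ℝ (Fin 3)),
      (∀ j, dist (y j) (y i) ≤ 12 * nearestDist y i → (P j = fccTwoShellPattern ∨ P j = hcpTwoShellPattern)) ∧
      (∀ j, dist (y j) (y i) ≤ 12 * nearestDist y i → ∀ v ∈ P j, ‖A j v - Qf j v‖ ≤ 1 / 1000) ∧
      (∀ j, dist (y j) (y i) ≤ 12 * nearestDist y i → ∀ v ∈ P j,
        f j v ∈ Set.range y ∧ dist (f j v) (y j + nearestDist y j • A j v) ≤ 1 / 10 ^ 4 * nearestDist y j) ∧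
      (∀ j, dist (y j) (y i) ≤ 12 * nearestDist y i → Set.InjOn (f j) ↑(P j)) ∧
      (∀ j, dist (y j) (y i) ≤ 12 * nearestDist y i → ∀ m, m ≠ j → dist (y m) (y j) ≤ (3 / 2 + 1 / 450) * nearestDist y j →
        ∃ v ∈ P j, f j v = y m) ∧
      ∃ (s : T3) (hs : IsSign s) (ref : ℤ → T3) (Cz : ℤ → List T3) (e : ℤ → ℤ),
        (∀ ℓ : ℤ, -5 ≤ ℓ → ℓ ≤ 5 → Cz ℓ ∈ [fccL, fccNegL, hcpL, hcpAltL] ∧ thsum (ref ℓ) = 6 * ℓ ∧ (ref ℓ).2.1 = (ref ℓ).1 ∧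
          (3 : ℤ) ∣ ((ref ℓ).2.1 - (ref ℓ).2.2) ∧
          ∀ u : T3, InLayer (tsub (tadd (2 * ℓ, 2 * ℓ, 2 * ℓ) u) (ref ℓ)) → |u.1| ≤ 18 - |ℓ| → |u.2.1| ≤ 18 - |ℓ| → |u.2.2| ≤ 18 - |ℓ| →
            ∃ k : Fin N, ∃ M : EuclideanSpace ℝ (Fin 3) →ₗᵢ[ℝ] EuclideanSpace ℝ (Fin 3),
              dist (y k) (y i) ≤ 12 * nearestDist y i ∧ 9026 / 10000 * nearestDist y i ≤ nearestDist y k ∧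
              nearestDist y k ≤ 10347 / 10000 * nearestDist y i ∧
              Estab y A P ((nearestDist y i • A i) ∘ₗ (flipIso s hs).toLinearMap) i k M (Cz ℓ) (tadd (2 * ℓ, 2 * ℓ, 2 * ℓ) u)
                (tauR (nearestDist y i) 31) (dR (nearestDist y i) 31)) ∧
        (∀ ℓ : ℤ, -5 ≤ ℓ → ℓ ≤ 4 → (e ℓ = 1 ∨ e ℓ = -1) ∧ ref (ℓ + 1) = tadd (ref ℓ) (capv 1 (e ℓ) (1, 1, -2)) ∧
          (∀ δ ∈ dL, capv 1 (e ℓ) δ ∈ Cz ℓ) ∧ (∀ δ ∈ dL, capv (-1) (-(e ℓ)) δ ∈ Cz (ℓ + 1))) ∧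
        (∃ x₀ : T3, InLayer x₀ ∧ tadd (ref 0) x₀ = (0, 0, 0)) ∧
        (∀ m, dist (y m) (y i) ≤ 106 / 25 * nearestDist y i → ∃ (ℓ : ℤ) (x : T3), -5 ≤ ℓ ∧ ℓ ≤ 5 ∧ InLayer x ∧
          ‖y m - y i - ((nearestDist y i • A i) ∘ₗ (flipIso s hs).toLinearMap) (mv (tadd (ref ℓ) x))‖ ≤
            dR (nearestDist y i) 31 + 1 / 10 ^ 4 * (10347 / 10000 * nearestDist y i) + tauR (nearestDist y i) 31 ∧
          9967 / 10000 * (9026 / 10000 * nearestDist y i) ≤ nearestDist y m) ∧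
        (∀ (m m' : Fin N) (r : T3), 9967 / 10000 * (9026 / 10000 * nearestDist y i) ≤ nearestDist y m' →
          ‖y m - y i - ((nearestDist y i • A i) ∘ₗ (flipIso s hs).toLinearMap) (mv r)‖ ≤
            dR (nearestDist y i) 31 + 1 / 10 ^ 4 * (10347 / 10000 * nearestDist y i) + tauR (nearestDist y i) 31 →
          ‖y m' - y i - ((nearestDist y i • A i) ∘ₗ (flipIso s hs).toLinearMap) (mv r)‖ ≤
            dR (nearestDist y i) 31 + 1 / 10 ^ 4 * (10347 / 10000 * nearestDist y i) + tauR (nearestDist y i) 31 → m = m') ∧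
        (∀ (m : Fin N) (ℓ : ℤ) (x : T3) (ℓ' : ℤ) (x' : T3), -5 ≤ ℓ → ℓ ≤ 5 → -5 ≤ ℓ' → ℓ' ≤ 5 → InLayer x → InLayer x' →
          ‖y m - y i - ((nearestDist y i • A i) ∘ₗ (flipIso s hs).toLinearMap) (mv (tadd (ref ℓ) x))‖ ≤
            dR (nearestDist y i) 31 + 1 / 10 ^ 4 * (10347 / 10000 * nearestDist y i) + tauR (nearestDist y i) 31 →
          ‖y m - y i - ((nearestDist y i • A i) ∘ₗ (flipIso s hs).toLinearMap) (mv (tadd (ref ℓ') x'))‖ ≤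
            dR (nearestDist y i) 31 + 1 / 10 ^ 4 * (10347 / 10000 * nearestDist y i) + tauR (nearestDist y i) 31 →
          tadd (ref ℓ) x = tadd (ref ℓ') x') := by
  have hreg' : AffDeepReg 12 (1 / 10 ^ 4) (1 / 1000) (1 / 450) y i := affDeepReg_rebase hreg hi
  exact layer_rigidity_of_affDeepReg hy (nearestDist_pos_of_affDeepReg hy (by norm_num) hreg') hreg'

/-! ## §3 One chart datum for the whole atlas -/

/-- **CHART DATA FROM `AffDeepReg ρ`** (the tree's `charts_of_affDeepReg` with the radius generic): chart data `A, Qf, P, f` on all of `Fin N` (choice on the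
`ρν`-ball, junk elsewhere) with the five ball hypotheses on `B(y c, ρ·ν_c)` and, for `0 ≤ ρ`, the two base-frame bounds. [this file · kind: proof] -/
theorem charts_of_affDeepReg_radius {ρ : ℝ} (hρ : 0 ≤ ρ) {y : Fin N → EuclideanSpace ℝ (Fin 3)} {c : Fin N}
    (hreg : AffDeepReg ρ (1 / 10 ^ 4) (1 / 1000) (1 / 450) y c) :
    ∃ (A : Fin N → (EuclideanSpace ℝ (Fin 3) →ₗ[ℝ] EuclideanSpace ℝ (Fin 3))) (Qf : Fin N → (EuclideanSpace ℝ (Fin 3) →ₗᵢ[ℝ] EuclideanSpace ℝ (Fin 3)))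
      (P : Fin N → Finset (EuclideanSpace ℝ (Fin 3))) (f : Fin N → EuclideanSpace ℝ (Fin 3) → EuclideanSpace ℝ (Fin 3)),
      (∀ j, dist (y j) (y c) ≤ ρ * nearestDist y c → (P j = fccTwoShellPattern ∨ P j = hcpTwoShellPattern)) ∧
      (∀ j, dist (y j) (y c) ≤ ρ * nearestDist y c → ∀ v ∈ P j, ‖A j v - Qf j v‖ ≤ 1 / 1000) ∧
      (∀ j, dist (y j) (y c) ≤ ρ * nearestDist y c → ∀ v ∈ P j,
        f j v ∈ Set.range y ∧ dist (f j v) (y j + nearestDist y j • A j v) ≤ 1 / 10 ^ 4 * nearestDist y j) ∧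
      (∀ j, dist (y j) (y c) ≤ ρ * nearestDist y c → Set.InjOn (f j) ↑(P j)) ∧
      (∀ j, dist (y j) (y c) ≤ ρ * nearestDist y c → ∀ m, m ≠ j → dist (y m) (y j) ≤ (3 / 2 + 1 / 450) * nearestDist y j →
        ∃ v ∈ P j, f j v = y m) ∧
      (∀ z, 399 / 400 * nearestDist y c * ‖z‖ ≤ ‖(nearestDist y c • A c) z‖) ∧
      (∀ z, ‖(nearestDist y c • A c) z‖ ≤ 401 / 400 * nearestDist y c * ‖z‖) := by
  classical
  have key : ∀ j : Fin N, ∃ (Q : EuclideanSpace ℝ (Fin 3) →ₗᵢ[ℝ] EuclideanSpace ℝ (Fin 3)) (A : EuclideanSpace ℝ (Fin 3) →ₗ[ℝ] EuclideanSpace ℝ (Fin 3))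
      (P : Finset (EuclideanSpace ℝ (Fin 3))) (f : EuclideanSpace ℝ (Fin 3) → EuclideanSpace ℝ (Fin 3)), dist (y j) (y c) ≤ ρ * nearestDist y c →
      (P = fccTwoShellPattern ∨ P = hcpTwoShellPattern) ∧ (∀ v ∈ P, ‖A v - Q v‖ ≤ 1 / 1000) ∧
      (∀ v ∈ P, f v ∈ Set.range y ∧ dist (f v) (y j + nearestDist y j • A v) ≤ 1 / 10 ^ 4 * nearestDist y j) ∧ Set.InjOn f ↑P ∧
      ∀ k : Fin N, k ≠ j → dist (y k) (y j) ≤ (3 / 2 + 1 / 450) * nearestDist y j → ∃ v ∈ P, f v = y k := by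
    intro j
    by_cases h : dist (y j) (y c) ≤ ρ * nearestDist y c
    · obtain ⟨Q, A, P, f, hF⟩ := (hreg j h).2
      exact ⟨Q, A, P, f, fun _ => hF⟩
    · exact ⟨LinearIsometry.id, 0, fccTwoShellPattern, fun _ => y j, fun h' => absurd h' h⟩
  choose Qf A P f hF using key
  have hc0 : dist (y c) (y c) ≤ ρ * nearestDist y c := by rw [dist_self]; exact mul_nonneg hρ (nearestDist_nonneg y c)
  have hPc := (hF c hc0).1
  have hAc := (hF c hc0).2.1
  exact ⟨A, Qf, P, f, fun j hj => (hF j hj).1, fun j hj => (hF j hj).2.1, fun j hj => (hF j hj).2.2.1, fun j hj => (hF j hj).2.2.2.1,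
    fun j hj => (hF j hj).2.2.2.2, base_lower hPc hAc, base_upper hPc hAc⟩

/-- **BALL RESTRICTION**: a clause holding for every site of `B(y c, ρ·ν_c)` holds for every site of `B(y i, 12·ν_i)` once `12·ν_i + dist (y i) (y c) ≤ ρ·ν_c`.
[this file · kind: glue] -/
theorem ball_restrict {ρ : ℝ} {y : Fin N → EuclideanSpace ℝ (Fin 3)} {c i : Fin N} {R : Fin N → Prop}
    (hi : 12 * nearestDist y i + dist (y i) (y c) ≤ ρ * nearestDist y c) (h : ∀ j, dist (y j) (y c) ≤ ρ * nearestDist y c → R j) :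
    ∀ j, dist (y j) (y i) ≤ 12 * nearestDist y i → R j := by
  intro j hj
  apply h j
  calc dist (y j) (y c) ≤ dist (y j) (y i) + dist (y i) (y c) := dist_triangle _ _ _
    _ ≤ 12 * nearestDist y i + dist (y i) (y c) := by linarith
    _ ≤ ρ * nearestDist y c := hi

/-- ★★ **LAYER RIGIDITY RE-BASED ON ONE CHART DATUM** (atlas form): chart data `A, Qf, P, f` with the five ball hypotheses on `B(y c, ρ·ν_c)` and a site `i` with
`12·ν_i + dist (y i) (y c) ≤ ρ·ν_c` give the stacking datum of `…CompressedCutReading.layer_rigidity_record` AT `i`, in the frame `(ν_i • A i) ∘ flipIso s` built from the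
SAME data (so that two such data at different bases are linked through the common own-chart frames `ν_m • A m`, memo §10.3). [this file · kind: proof] -/
theorem layer_rigidity_rebase_charts {ρ : ℝ} {y : Fin N → EuclideanSpace ℝ (Fin 3)} (hy : Function.Injective y) {c i : Fin N}
    {A : Fin N → (EuclideanSpace ℝ (Fin 3) →ₗ[ℝ] EuclideanSpace ℝ (Fin 3))} {Qf : Fin N → (EuclideanSpace ℝ (Fin 3) →ₗᵢ[ℝ] EuclideanSpace ℝ (Fin 3))}
    {P : Fin N → Finset (EuclideanSpace ℝ (Fin 3))} {f : Fin N → EuclideanSpace ℝ (Fin 3) → EuclideanSpace ℝ (Fin 3)}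
    (hP : ∀ j, dist (y j) (y c) ≤ ρ * nearestDist y c → (P j = fccTwoShellPattern ∨ P j = hcpTwoShellPattern))
    (hA : ∀ j, dist (y j) (y c) ≤ ρ * nearestDist y c → ∀ v ∈ P j, ‖A j v - Qf j v‖ ≤ 1 / 1000)
    (hf : ∀ j, dist (y j) (y c) ≤ ρ * nearestDist y c → ∀ v ∈ P j,
      f j v ∈ Set.range y ∧ dist (f j v) (y j + nearestDist y j • A j v) ≤ 1 / 10 ^ 4 * nearestDist y j)
    (hinj : ∀ j, dist (y j) (y c) ≤ ρ * nearestDist y c → Set.InjOn (f j) ↑(P j))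
    (hex : ∀ j, dist (y j) (y c) ≤ ρ * nearestDist y c → ∀ m, m ≠ j → dist (y m) (y j) ≤ (3 / 2 + 1 / 450) * nearestDist y j →
      ∃ v ∈ P j, f j v = y m)
    (hi : 12 * nearestDist y i + dist (y i) (y c) ≤ ρ * nearestDist y c) :
    ∃ (s : T3) (hs : IsSign s) (ref : ℤ → T3) (Cz : ℤ → List T3) (e : ℤ → ℤ),
      (∀ ℓ : ℤ, -5 ≤ ℓ → ℓ ≤ 5 → Cz ℓ ∈ [fccL, fccNegL, hcpL, hcpAltL] ∧ thsum (ref ℓ) = 6 * ℓ ∧ (ref ℓ).2.1 = (ref ℓ).1 ∧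
        (3 : ℤ) ∣ ((ref ℓ).2.1 - (ref ℓ).2.2) ∧
        ∀ u : T3, InLayer (tsub (tadd (2 * ℓ, 2 * ℓ, 2 * ℓ) u) (ref ℓ)) → |u.1| ≤ 18 - |ℓ| → |u.2.1| ≤ 18 - |ℓ| → |u.2.2| ≤ 18 - |ℓ| →
          ∃ k : Fin N, ∃ M : EuclideanSpace ℝ (Fin 3) →ₗᵢ[ℝ] EuclideanSpace ℝ (Fin 3),
            dist (y k) (y i) ≤ 12 * nearestDist y i ∧ 9026 / 10000 * nearestDist y i ≤ nearestDist y k ∧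
            nearestDist y k ≤ 10347 / 10000 * nearestDist y i ∧
            Estab y A P ((nearestDist y i • A i) ∘ₗ (flipIso s hs).toLinearMap) i k M (Cz ℓ) (tadd (2 * ℓ, 2 * ℓ, 2 * ℓ) u)
              (tauR (nearestDist y i) 31) (dR (nearestDist y i) 31)) ∧
      (∀ ℓ : ℤ, -5 ≤ ℓ → ℓ ≤ 4 → (e ℓ = 1 ∨ e ℓ = -1) ∧ ref (ℓ + 1) = tadd (ref ℓ) (capv 1 (e ℓ) (1, 1, -2)) ∧
        (∀ δ ∈ dL, capv 1 (e ℓ) δ ∈ Cz ℓ) ∧ (∀ δ ∈ dL, capv (-1) (-(e ℓ)) δ ∈ Cz (ℓ + 1))) ∧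
      (∃ x₀ : T3, InLayer x₀ ∧ tadd (ref 0) x₀ = (0, 0, 0)) ∧
      (∀ m, dist (y m) (y i) ≤ 106 / 25 * nearestDist y i → ∃ (ℓ : ℤ) (x : T3), -5 ≤ ℓ ∧ ℓ ≤ 5 ∧ InLayer x ∧
        ‖y m - y i - ((nearestDist y i • A i) ∘ₗ (flipIso s hs).toLinearMap) (mv (tadd (ref ℓ) x))‖ ≤
          dR (nearestDist y i) 31 + 1 / 10 ^ 4 * (10347 / 10000 * nearestDist y i) + tauR (nearestDist y i) 31 ∧
        9967 / 10000 * (9026 / 10000 * nearestDist y i) ≤ nearestDist y m) ∧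
      (∀ (m m' : Fin N) (r : T3), 9967 / 10000 * (9026 / 10000 * nearestDist y i) ≤ nearestDist y m' →
        ‖y m - y i - ((nearestDist y i • A i) ∘ₗ (flipIso s hs).toLinearMap) (mv r)‖ ≤
          dR (nearestDist y i) 31 + 1 / 10 ^ 4 * (10347 / 10000 * nearestDist y i) + tauR (nearestDist y i) 31 →
        ‖y m' - y i - ((nearestDist y i • A i) ∘ₗ (flipIso s hs).toLinearMap) (mv r)‖ ≤
          dR (nearestDist y i) 31 + 1 / 10 ^ 4 * (10347 / 10000 * nearestDist y i) + tauR (nearestDist y i) 31 → m = m') ∧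
      (∀ (m : Fin N) (ℓ : ℤ) (x : T3) (ℓ' : ℤ) (x' : T3), -5 ≤ ℓ → ℓ ≤ 5 → -5 ≤ ℓ' → ℓ' ≤ 5 → InLayer x → InLayer x' →
        ‖y m - y i - ((nearestDist y i • A i) ∘ₗ (flipIso s hs).toLinearMap) (mv (tadd (ref ℓ) x))‖ ≤
          dR (nearestDist y i) 31 + 1 / 10 ^ 4 * (10347 / 10000 * nearestDist y i) + tauR (nearestDist y i) 31 →
        ‖y m - y i - ((nearestDist y i • A i) ∘ₗ (flipIso s hs).toLinearMap) (mv (tadd (ref ℓ') x'))‖ ≤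
          dR (nearestDist y i) 31 + 1 / 10 ^ 4 * (10347 / 10000 * nearestDist y i) + tauR (nearestDist y i) 31 →
        tadd (ref ℓ) x = tadd (ref ℓ') x') := by
  have hP' := ball_restrict hi hP
  have hA' := ball_restrict hi hA
  have hf' := ball_restrict hi hf
  have hinj' := ball_restrict hi hinj
  have hex' := ball_restrict hi hex
  have hi0 : dist (y i) (y i) ≤ 12 * nearestDist y i := by
    rw [dist_self]; exact mul_nonneg (by norm_num) (nearestDist_nonneg y i)
  have hν : 0 < nearestDist y i := nearestDist_pos_of_frame hy (hP' i hi0) (fun v hv => (hf' i hi0 v hv).1) (hinj' i hi0)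
  exact layer_rigidity_record hy hν hP' hA' hf' hinj' hex' (base_lower (hP' i hi0) (hA' i hi0)) (base_upper (hP' i hi0) (hA' i hi0))

end Summit.AtomisticToContinuum.Crystallization.Theorems.OverbindingBudgetAffineRunCutRebase
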